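import Summits.CriticalPhenomena.PercolationContinuityZ3.Theorems.TallClusterMassBound.Negative.FalseWithoutCriticality
import Summits.CriticalPhenomena.PercolationContinuityZ3.Theorems.PercLowPointHalfSpaceQuantitativeBGNKlTransfer
import Literature.Probability.Percolation.HalfSpaceFloorDilution
import Literature.Probability.Percolation.HutchcroftVolumeTail
import Literature.Probability.Percolation.BondCentralInequality
import Literature.Probability.Percolation.ConstrainedClusters
import Literature.Probability.Percolation.SusceptibilityGammaOne
import Literature.Probability.Percolation.CriticalContinuityProofs
import Mathlib.Analysis.SpecialFunctions.Pow.Real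

/-!
# `TallClusterMassBound` (stmt-CriticalPhenomena-0912), line `SketchIdeator4` —
# helper for stub `stub_crossoverTransfer`: the KL volume tail on the induced half-space

CLOSED helper file (first of two) for the registered stub `stub_crossoverTransfer` (ARROW 2′ of the
line: a subcritical SURFACE susceptibility profile gives a sub-volume typical maximum of the induced
half-space percolation). Vocabulary: `Hs = ℍ = {x | 0 ≤ x₀}`, `Pp p = P_p` on `ℤ³`, `up h = (h,0,0)`
(`Negative.MassExponentFamily`); `G_ℍ := withinGraph (zdGraph 3) Hs` (lattice steps inside `ℍ`);
`PcH := floorDilutedPercolation 3 p_c 1`.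

* `bondPercolation_withinGraph_Hs_eq` — KEY IDENTIFICATION: `bondPercolation G_ℍ p = floorDilutedPercolation 3 p 1`
  as measures (the same product Bernoulli weights: `p` on the lattice edges inside `ℍ`, `0` elsewhere).
* `degree_withinGraph_Hs_le` — `Δ(G_ℍ) ≤ 6`.
* `bondPercolation_withinGraph_openConn_eq` — `P^{G_ℍ}_p(v ↔ y) = P_p(v ↔ y in ℍ)` for `v ∈ ℍ`
  (a.s. `ω ⊆ E(G_ℍ)`, `openClusterIn_withinGraph_eq_top`, `openConnIn_eq_openConnVia`,
  `floorDilutedPercolation_one_openConnIn`).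
* `expClusterSize_withinGraph_le` — `E^{G_ℍ}_p|C(v)| = Σ_y P(v ↔ y) ≤ sup_R Σ_{B_R} P_p(v ↔ x in ℍ)`.
* `real_openConnIn_Hs_add`, `sum_box_real_openConnIn_le` — lateral translation invariance: the box
  sums at `v ∈ ℍ` are dominated by box sums at the axis point `up v₀`.
* `floorDiluted_real_clusterSizeGe_le_of_surfaceProfile` (the registered closed helper) —
  `PcH(|C_ℍ(v)| ≥ n) ≤ K (v₀+1)^κ n^{-(1-γ₁/2)}` from the profile bound
  `Σ_{B_R} P_p((h,0,0) ↔ x in ℍ) ≤ C (p_c-p)^{-γ₁} (h+1)^κ`: Hutchcroft's KL lemma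
  `ClusterExploration.real_clusterSizeGe_le_of_kl` on `G_ℍ` at `(p_c - ε, p_c)`, `ε = (p_c/2) n^{-1/2}`,
  Markov, and `kl ≤ ε²/(p_c(1-p_c))` (`QuantitativeBGNKlTransfer.binaryKL_le_sq_div`).
-/

noncomputable section

open MeasureTheory Finset Filter
open Literature.Probability.Percolation Literature.Probability.LatticeModels
open Literature.Probability.Entropy
open Summit.CriticalPhenomena.PercolationContinuityZ3.Theorems.TallClusterMassBound.Negative
open scoped ENNReal

namespace Summit.CriticalPhenomena.PercolationContinuityZ3.Theorems.TallClusterMassBound.TightnessLine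

/-- **Key identification.** Bond percolation on the induced half-space graph
`withinGraph (zdGraph 3) ℍ` is the floor-diluted measure at `s = 1`: both are product Bernoulli
measures with weight `p` on the lattice edges inside `ℍ` and `0` elsewhere. [folklore] -/
theorem bondPercolation_withinGraph_Hs_eq (p : unitInterval) :
    bondPercolation (withinGraph (zdGraph 3) Hs) p = floorDilutedPercolation 3 p 1 := by
  classical
  rw [floorDilutedPercolation, bondPercolation, ← prodBernoulli_indicator_holds]
  congr 1
  funext e
  have hiff : e ∈ (withinGraph (zdGraph 3) Hs).edgeSet ↔ e ∈ halfSpaceEdgeSet 3 := by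
    induction e using Sym2.ind with
    | h u v =>
      rw [mem_edgeSet_withinGraph, mem_halfSpaceEdgeSet_iff, SimpleGraph.mem_edgeSet]
      simp only [Sym2.mem_iff, forall_eq_or_imp, forall_eq, Hs, Set.mem_setOf_eq]
  by_cases he : e ∈ halfSpaceEdgeSet 3
  · rw [if_pos (hiff.2 he), floorDilutedParam_one_of_mem_halfSpaceEdgeSet p he]
  · rw [if_neg (fun h => he (hiff.1 h)), floorDilutedParam_of_not_mem_halfSpaceEdgeSet p 1 he]

/-- The induced half-space graph has maximal degree `6`. [folklore] -/
theorem degree_withinGraph_Hs_le (v : V3) : (withinGraph (zdGraph 3) Hs).degree v ≤ 6 := by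
  classical
  refine le_trans ?_ (degree_zdGraph_le v)
  rw [← SimpleGraph.card_neighborFinset_eq_degree, ← SimpleGraph.card_neighborFinset_eq_degree]
  refine Finset.card_le_card fun w hw => ?_
  rw [SimpleGraph.mem_neighborFinset] at hw ⊢
  exact hw.1


/-- Under bond percolation on the induced half-space graph, the plain connection event
`{v ↔ y}` and the route's `{v ↔ y in ℍ}` have the same probability, and the latter is computed by
bond percolation on `ℤ³` (`floorDilutedPercolation_one_openConnIn`): for `v ∈ ℍ`,
`P^{G_ℍ}_p(v ↔ y) = P_p(v ↔ y in ℍ)`. [folklore] -/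
theorem bondPercolation_withinGraph_openConn_eq (p : unitInterval) {v : V3} (hv : v ∈ Hs) (y : V3) :
    bondPercolation (withinGraph (zdGraph 3) Hs) p (openConn v y) = Pp p (openConnIn Hs v y) := by
  have h1 : bondPercolation (withinGraph (zdGraph 3) Hs) p (openConn v y) =
      bondPercolation (withinGraph (zdGraph 3) Hs) p (openConnIn Hs v y) := by
    refine measure_congr ?_
    have hae : ∀ᵐ ω ∂bondPercolation (withinGraph (zdGraph 3) Hs) p,
        ω ⊆ (withinGraph (zdGraph 3) Hs).edgeSet := ProbabilityTheory.setBernoulli_ae_subset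
    filter_upwards [hae] with ω hω
    have hω' : ω ⊆ (zdGraph 3).edgeSet :=
      hω.trans (SimpleGraph.edgeSet_subset_edgeSet.2 (withinGraph_le _ _))
    refine propext ?_
    change (openGraph ω).Reachable v y ↔ ω ∈ openConnIn Hs v y
    rw [openConnIn_eq_openConnVia hv]
    change (openGraph ω).Reachable v y ↔ y ∈ openClusterIn (withinGraph ⊤ Hs) ω v
    rw [← openClusterIn_withinGraph_eq_top (zdGraph 3) Hs hω' v, openClusterIn,
      Set.inter_eq_left.2 hω]
    rfl
  rw [h1, bondPercolation_withinGraph_Hs_eq]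
  exact floorDilutedPercolation_one_openConnIn p (S := Hs) (fun _ h => h) v y

/-- **Surface susceptibility bound.** If the box sums `Σ_{x ∈ B_R} P_p(v ↔ x in ℍ)` are bounded by
`B` uniformly in `R`, then the mean cluster size of `v ∈ ℍ` on the induced half-space graph is at
most `B` (`E|C(v)| = Σ_y P(v ↔ y)`, Tonelli). [folklore] -/
theorem expClusterSize_withinGraph_le (p : unitInterval) {v : V3} (hv : v ∈ Hs) {B : ℝ}
    (hB : ∀ R : ℕ, ∑ x ∈ box 3 R, (Pp p).real (openConnIn Hs v x) ≤ B) :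
    expClusterSize (withinGraph (zdGraph 3) Hs) v p ≤ ENNReal.ofReal B := by
  rw [expClusterSize_eq_tsum, ENNReal.tsum_eq_iSup_sum' (box 3) DCT16.exists_subset_box]
  refine iSup_le fun R => ?_
  calc ∑ y ∈ box 3 R, bondPercolation (withinGraph (zdGraph 3) Hs) p (openConn v y)
      = ENNReal.ofReal (∑ y ∈ box 3 R, (Pp p).real (openConnIn Hs v y)) := by
        rw [ENNReal.ofReal_sum_of_nonneg (fun _ _ => measureReal_nonneg)]
        refine Finset.sum_congr rfl fun y _ => ?_
        rw [bondPercolation_withinGraph_openConn_eq p hv y, ofReal_measureReal (measure_ne_top _ _)]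
    _ ≤ ENNReal.ofReal B := ENNReal.ofReal_le_ofReal (hB R)

/-- **Lateral translation invariance** of `{u ↔ y in ℍ}`: a shift by `w` with `w₀ = 0` preserves
`ℍ` and `P_p`. [folklore] -/
theorem real_openConnIn_Hs_add (p : unitInterval) {w : V3} (hw : w 0 = 0) (u y : V3) :
    (Pp p).real (openConnIn Hs (u + w) (y + w)) = (Pp p).real (openConnIn Hs u y) := by
  have himage : (Site.shift w) '' Hs = Hs := by
    ext z
    simp only [Set.mem_image, Site.shift_apply, Hs, Set.mem_setOf_eq]
    constructor
    · rintro ⟨z', hz', rfl⟩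
      simpa [Pi.add_apply, hw] using hz'
    · intro hz
      exact ⟨z - w, by simpa [hw] using hz, sub_add_cancel z w⟩
  rw [Pp, ← bondPercolation_real_preimage_shift w p (openConnIn Hs (u + w) (y + w))]
  congr 1
  ext ω
  rw [Set.mem_preimage]
  have key := relabel_mem_openConnIn_iff (Site.shift w) ω Hs u y
  rw [himage] at key
  exact key

/-- The box sums at a root `v ∈ ℍ` of height `h = v₀` are dominated by box sums at the axis
point `up h = (h, 0, 0)` (translate laterally by `(0, v₁, v₂)` and enlarge the box). [folklore] -/
theorem sum_box_real_openConnIn_le (p : unitInterval) {v : V3} (hv : 0 ≤ v 0) (R : ℕ) :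
    ∃ R' : ℕ, ∑ x ∈ box 3 R, (Pp p).real (openConnIn Hs v x) ≤
      ∑ x ∈ box 3 R', (Pp p).real (openConnIn Hs (up (v 0).toNat) x) := by
  classical
  set w : V3 := v - up (v 0).toNat with hw_def
  have hw : w 0 = 0 := by
    rw [hw_def, Pi.sub_apply, up_apply_zero, Int.toNat_of_nonneg hv, sub_self]
  have hv' : v = up (v 0).toNat + w := by rw [hw_def]; abel
  obtain ⟨R', hR'⟩ := DCT16.exists_subset_box ((box 3 R).image fun x => x - w)
  refine ⟨R', ?_⟩
  have hterm : ∀ x, (Pp p).real (openConnIn Hs v x) =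
      (Pp p).real (openConnIn Hs (up (v 0).toNat) (x - w)) := by
    intro x
    conv_lhs => rw [hv', ← sub_add_cancel x w]
    exact real_openConnIn_Hs_add p hw _ _
  simp_rw [hterm]
  rw [← Finset.sum_image (f := fun y => (Pp p).real (openConnIn Hs (up (v 0).toNat) y))
    (fun x _ y _ h => sub_left_injective h)]
  exact Finset.sum_le_sum_of_subset_of_nonneg hR' fun _ _ _ => measureReal_nonneg

/-- **KL volume tail on the induced half-space, at a general root (CLOSED helper for
`stub_crossoverTransfer`).** If the subcritical surface susceptibility profile obeys
`Σ_{x ∈ B_R} P_p((h,0,0) ↔ x in ℍ) ≤ C (p_c - p)^{-γ₁} (h+1)^κ` for all `p < p_c`, `h`, `R`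
(`C > 0`), then for every `v ∈ ℍ` and `n ≥ 1` the cluster of `v` in bond percolation on the
INDUCED half-space at `p_c` (`floorDilutedPercolation 3 p_c 1`) satisfies
`P(|C_ℍ(v)| ≥ n) ≤ K (v₀ + 1)^κ n^{-(1 - γ₁/2)}`, `K = C ε₀^{-γ₁}(2 + 48 ε₀²/(p_c(1-p_c)))`,
`ε₀ = p_c/2`: Hutchcroft's KL lemma `real_clusterSizeGe_le_of_kl` on `withinGraph (zdGraph 3) ℍ`
(`Δ = 6`) at `(p, q) = (p_c - ε, p_c)`, `ε = ε₀ n^{-1/2}`, with `Σ_{j ≤ n} P_p(|C_ℍ(v)| ≥ j) ≤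
E_p|C_ℍ(v)| ≤ C ε^{-γ₁} (v₀+1)^κ` (lateral translation to the axis point `up v₀`), Markov
`n P_p(|C| ≥ n) ≤ Σ_{j ≤ n} P_p(|C| ≥ j)`, and `kl(p‖p_c) ≤ ε²/(p_c(1-p_c))` (the surface analogue of
`QuantitativeBGNKlTransfer.real_clusterSizeGe_criticalProb_le`, Hutchcroft 2022 Thm. 1.3 + Markov).
[folklore] -/
theorem floorDiluted_real_clusterSizeGe_le_of_surfaceProfile :
    ∀ (γ₁ κ C : ℝ), 0 < C →
      (∀ p : unitInterval, (p : ℝ) < criticalProb (zdGraph 3) (0 : V3) → ∀ h R : ℕ,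
        ∑ x ∈ box 3 R, (Pp p).real (openConnIn Hs (up h) x) ≤
          C * (criticalProb (zdGraph 3) (0 : V3) - (p : ℝ)) ^ (-γ₁) * ((h : ℝ) + 1) ^ κ) →
      ∃ K : ℝ, 0 < K ∧ ∀ v : V3, 0 ≤ v 0 → ∀ n : ℕ, 1 ≤ n →
        (floorDilutedPercolation 3 (criticalProbI 3) 1).real (clusterSizeGe v n) ≤
          K * (((v 0 : ℤ) : ℝ) + 1) ^ κ * (n : ℝ) ^ (-(1 - γ₁ / 2)) := by
  intro γ₁ κ C hC hS
  set pc : ℝ := criticalProb (zdGraph 3) (0 : V3) with hpc_def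
  have hpc0 : 0 < pc := criticalProb_zd_pos 3 (by norm_num)
  have hpc1 : pc < 1 := criticalProb_zd_lt_one (d := 3) (by norm_num)
  -- the scale-free part `ε₀` of `ε = ε₀ n^{-1/2}`
  set ε₀ : ℝ := pc / 2 with hε₀_def
  have hε₀pos : 0 < ε₀ := by rw [hε₀_def]; linarith
  refine ⟨C * ε₀ ^ (-γ₁) * (2 + 48 * (ε₀ ^ 2 / (pc * (1 - pc)))), ?_, fun v hv n hn => ?_⟩
  · have : 0 < 1 - pc := by linarith
    positivity
  have hn0 : (0 : ℝ) < n := by exact_mod_cast hn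
  have hn1 : (1 : ℝ) ≤ n := by exact_mod_cast hn
  -- the scale `s = n^{-1/2} ∈ (0, 1]`
  set s : ℝ := (n : ℝ) ^ (-(1 / 2 : ℝ)) with hs_def
  have hs0 : 0 < s := Real.rpow_pos_of_pos hn0 _
  have hs1 : s ≤ 1 := Real.rpow_le_one_of_one_le_of_nonpos hn1 (by norm_num)
  have hs2 : s ^ 2 = (n : ℝ)⁻¹ := by
    rw [hs_def, ← Real.rpow_natCast ((n : ℝ) ^ (-(1 / 2 : ℝ))) 2, ← Real.rpow_mul hn0.le,
      ← Real.rpow_neg_one]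
    congr 1
    norm_num
  have e2 : s ^ (-γ₁) * s ^ 2 = (n : ℝ) ^ (-(1 - γ₁ / 2)) := by
    rw [hs_def, ← Real.rpow_mul hn0.le, ← Real.rpow_natCast ((n : ℝ) ^ (-(1 / 2 : ℝ))) 2,
      ← Real.rpow_mul hn0.le, ← Real.rpow_add hn0]
    congr 1
    push_cast
    ring
  -- `ε = ε₀ s` and the subcritical parameter `p = p_c - ε`
  set ε : ℝ := ε₀ * s with hε_def
  have hε0 : 0 < ε := mul_pos hε₀pos hs0
  have hεle : ε ≤ ε₀ := by rw [hε_def]; exact mul_le_of_le_one_right hε₀pos.le hs1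
  have hp0 : 0 < pc - ε := by linarith
  have hp1 : pc - ε < 1 := by linarith
  set p : unitInterval := ⟨pc - ε, hp0.le, hp1.le⟩ with hp_def
  have hpcoe : (p : ℝ) = pc - ε := rfl
  have hplt : (p : ℝ) < pc := by rw [hpcoe]; linarith
  have hpe : pc - (p : ℝ) = ε := by rw [hpcoe]; ring
  -- the height of the root and positivity of the profile factor
  have hv0 : (0 : ℝ) ≤ ((v 0 : ℤ) : ℝ) := by exact_mod_cast hv
  have hhv : (((v 0).toNat : ℕ) : ℝ) = ((v 0 : ℤ) : ℝ) := by
    have : (((v 0).toNat : ℕ) : ℤ) = v 0 := Int.toNat_of_nonneg hv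
    exact_mod_cast this
  have hprof : 0 < (((v 0 : ℤ) : ℝ) + 1) ^ κ := Real.rpow_pos_of_pos (by linarith) κ
  have hM0 : 0 ≤ C * ε ^ (-γ₁) * (((v 0 : ℤ) : ℝ) + 1) ^ κ :=
    (mul_pos (mul_pos hC (Real.rpow_pos_of_pos hε0 _)) hprof).le
  -- the surface susceptibility of `v` at `p`: `E_p|C_ℍ(v)| ≤ C ε^{-γ₁} (v₀+1)^κ`
  have hχ : expClusterSize (withinGraph (zdGraph 3) Hs) v p ≤
      ENNReal.ofReal (C * ε ^ (-γ₁) * (((v 0 : ℤ) : ℝ) + 1) ^ κ) := by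
    refine expClusterSize_withinGraph_le p hv fun R => ?_
    obtain ⟨R', hR'⟩ := sum_box_real_openConnIn_le p hv R
    refine hR'.trans ?_
    have h := hS p hplt (v 0).toNat R'
    rw [hpe, hhv] at h
    exact h
  -- Hutchcroft's KL lemma on the induced half-space graph (`Δ = 6`) at `(p, p_c)`
  have hq0 : 0 < ((criticalProbI 3 : unitInterval) : ℝ) := hpc0
  have hq1 : ((criticalProbI 3 : unitInterval) : ℝ) < 1 := hpc1
  have hK := ClusterExploration.real_clusterSizeGe_le_of_kl (G := withinGraph (zdGraph 3) Hs)
    (n := n) degree_withinGraph_Hs_le v p (criticalProbI 3) (by rw [hpcoe]; exact hp0)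
    (by rw [hpcoe]; exact hp1) hq0 hq1
  -- the truncated mean `S_n ≤ M`
  set S : ℝ := ∑ j ∈ Finset.Icc 1 n,
    (bondPercolation (withinGraph (zdGraph 3) Hs) p).real (clusterSizeGe v j) with hS_def
  have hSM : S ≤ C * ε ^ (-γ₁) * (((v 0 : ℤ) : ℝ) + 1) ^ κ :=
    (ENNReal.ofReal_le_ofReal_iff hM0).1
      ((ofReal_sum_real_clusterSizeGe_le (withinGraph (zdGraph 3) Hs) v p n).trans hχ)
  -- Markov: `n · P_p(|C| ≥ n) ≤ S_n ≤ M`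
  have ha : (bondPercolation (withinGraph (zdGraph 3) Hs) p).real (clusterSizeGe v n) ≤
      C * ε ^ (-γ₁) * (((v 0 : ℤ) : ℝ) + 1) ^ κ / n := by
    rw [le_div_iff₀ hn0, mul_comm]
    exact (klSurfaceTail_mul_real_clusterSizeGe_le_sum (withinGraph (zdGraph 3) Hs) v p n).trans hSM
  -- the chi-square bound on the KL price: `kl(p ‖ p_c) ≤ ε² / (p_c (1 - p_c))`
  have hkl : binaryKL (p : ℝ) ((criticalProbI 3 : unitInterval) : ℝ) ≤ ε ^ 2 / (pc * (1 - pc)) := by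
    have h := QuantitativeBGNKlTransfer.binaryKL_le_sq_div (a := pc - ε) (b := pc) hp0.le hp1.le
      hpc0 hpc1
    have e : (pc - ε - pc) ^ 2 = ε ^ 2 := by ring
    rw [e] at h
    exact h
  have hS0 : 0 ≤ S := Finset.sum_nonneg fun _ _ => measureReal_nonneg
  -- the measure at `p_c` is bond percolation on the induced half-space graph
  rw [← bondPercolation_withinGraph_Hs_eq]
  calc (bondPercolation (withinGraph (zdGraph 3) Hs) (criticalProbI 3)).real (clusterSizeGe v n)
      ≤ 2 * (bondPercolation (withinGraph (zdGraph 3) Hs) p).real (clusterSizeGe v n) +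
          8 * ((6 : ℕ) : ℝ) * binaryKL (p : ℝ) ((criticalProbI 3 : unitInterval) : ℝ) * S := hK
    _ ≤ 2 * (C * ε ^ (-γ₁) * (((v 0 : ℤ) : ℝ) + 1) ^ κ / n) +
          8 * ((6 : ℕ) : ℝ) * (ε ^ 2 / (pc * (1 - pc))) *
            (C * ε ^ (-γ₁) * (((v 0 : ℤ) : ℝ) + 1) ^ κ) := by
        refine add_le_add (mul_le_mul_of_nonneg_left ha (by norm_num)) ?_
        have h1 : 8 * ((6 : ℕ) : ℝ) * binaryKL (p : ℝ) ((criticalProbI 3 : unitInterval) : ℝ) * S ≤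
            8 * ((6 : ℕ) : ℝ) * (ε ^ 2 / (pc * (1 - pc))) * S :=
          mul_le_mul_of_nonneg_right (mul_le_mul_of_nonneg_left hkl (by positivity)) hS0
        refine h1.trans (mul_le_mul_of_nonneg_left hSM ?_)
        have : 0 < 1 - pc := by linarith
        positivity
    _ = C * ε₀ ^ (-γ₁) * (2 + 48 * (ε₀ ^ 2 / (pc * (1 - pc)))) * (((v 0 : ℤ) : ℝ) + 1) ^ κ *
          (n : ℝ) ^ (-(1 - γ₁ / 2)) := by
        rw [← e2, hε_def, Real.mul_rpow hε₀pos.le hs0.le, div_eq_mul_inv _ (n : ℝ), ← hs2]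
        push_cast
        ring

end Summit.CriticalPhenomena.PercolationContinuityZ3.Theorems.TallClusterMassBound.TightnessLine

end
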